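import Summits.AtomisticToContinuum.HydrodynamicLimit.Theorems.DiffuseBackwardInfluence.Negative.FreeDirection

/-!
# Line `caged-stratum-pricing` — skeleton for the crux `CollisionIsometryCLT.DiffuseBackwardInfluence`
(crux item stmt-AtomisticToContinuum-12950, rank 3; route `route-AtomisticToContinuum-CollisionIsometryCLT`)

Crux (FIXED, by name): for all continuous positive profiles `∃ σ₀ ∀ σ < σ₀ ∀ Φ ∀ Δ_N`
(`Δ_N > 0`, `Δ_N → 0`, `Δ_N (N+1)^{1/3} → ∞`) `∀ t > 0`: `E_localGibbs[ipr N (Φ_{t−Δ_N} z) Δ_N] → 0`, where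
`ipr = (N+1)⁻¹ Σᵢ Σₖ ‖M_ik‖_F⁴ ∈ [9/(N+1), 9]` is the mean inverse participation ratio of the rows of the
frozen-geometry velocity transfer `M` over the window (the crux's own `let M …; let ipr …`; here the landed
definitions `transfer` / `ipr` / `normalAt` of `Theorems/DiffuseBackwardInfluence/Negative/TransferKernels.lean`,
which are the crux's `let`s definitionally — `fewIdle_of_diffuseBackwardInfluence` consumes the crux through them).

## Idea (crux idea `caged-stratum-pricing`, triage r1-2: pass, r1-3: pass)

The landed negative kernels say WHAT can keep a row of `M` heavy through `n_N → ∞` collisions: collision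
poverty (`nine_mul_idleFrac_le_ipr`, `lowCollFrac_le_ipr`: `≤ 2` own collisions ⇒ `rowIpr ≥ 1`) and DEGENERATE OWN
NORMALS (`one_le_ipr_of_planar`: a direction `e` orthogonal to all own normals of `i` is a conserved component,
`rowIpr_i ≥ 1` for ever; the coordinate-cage kernel `coordinateNormalsNoSplit_holds` of the ideator sketch). The
card's lever: PERSISTENT degeneracy of a particle's own normals needs a POSITIONAL CAGE, and cages dichotomise by
their gap `ρ ε` (`ε = hsDiameter σ N`):
* TIGHT cages (`ρ ≤ ρ_N → 0`) are priced by equilibrium STATICS alone — a positive fraction of spheres with a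
  neighbour within gap `ρ_N ε` has homogeneous-Gibbs probability `exp(−(N+1)·κ·log(1/ρ_N)·(1+o(1)))`,
  SUPER-exponential because `ρ_N → 0` (`stub_tightBondsSuperExp`, provable now: matching extraction + shell volumes
  + `e^{O(N)}` hard-core conditioning);
* LOOSE cages (`ρ ≫ σ³/n_N`, typed: `ρ_N Δ_N (N+1)^{1/3} → ∞`) cannot keep the normals degenerate: the caged particle
  bounces `≍ n_N ℓ/(ρε)` times in the window and each bounce tilts the contact normal by `≍ ρ` incoherently, so the
  accumulated squared component of the own unit normals along EVERY direction grows like `n_N ℓ ρ/ε → ∞`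
  (dispersing instability makes coherent rattling a velocity fine-tuning of super-exponential cost; in the gas phase
  `m_N → ∞` chance-coplanar arrivals are super-exponentially rare) — `stub_cageDichotomy`, the load-bearing stub OF
  THIS IDEA, a statement about COLLISION GEOMETRY ONLY (no transfer in it);
and everything super-exponentially rare under the invariant law is negligible in local-Gibbs MEAN by the entropy
transfer (`O(N)` relative entropy, Kipnis–Landim A1.8.2 — `stub_entropyTransfer`, `stub_gibbsInvariance`, shared
verbatim with line `ballistic-tubes`). What is left is ONE transfer statement, the residual and hardest stub
`stub_dispersedNoReconcentration`: rows of particles that are ACTIVE (`> m_N → ∞` own collisions) and DISPERSED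
(accumulated squared own-normal component `≥ Λ_N → ∞` along every direction — the quantitative negation of the
free-direction kernel) do not stay concentrated, super-exponentially surely under the invariant law, given that
collision-poor, tightly-bonded and loose-degenerate particles are each fewer than `δ'(N+1)`. It is strictly weaker
than the `NoReconcentration` stubs of lines `superexp-entropy-transfer` / `ballistic-tubes` (two more pointwise
hypotheses, three tools) and is where `right-angle-rigidity` / `coalescing-influence-tracers` / `gram-coherence-cascade`
plug in.

  crux ⇐ entropy transfer (S2) ∘ invariance (S1) ∘ row budget (`TransferIsometry`, route support, BY NAME) ∘
  [ `G_N{δ < ipr} ≤ 4 e^{−(c+3)(N+1)}` ⇐ union of FOUR strata: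
      POOR (S3 few collisions) ∪ BOND (S4 tight bonds, statics) ∪ LOOSE-DEGENERATE (S5 cage dichotomy) ∪ RESIDUAL (S6) ].

## Stubs (6, registered) and composition
`stub_gibbsInvariance` (S–M, = shared item GibbsInvariance 9239 verbatim) · `stub_entropyTransfer` (M, verbatim the
`ballistic-tubes` stub: one proof serves both lines) · `stub_fewCollisionsSuperExp` (L, shared content with both sibling
lines, `∃ m_N → ∞` form) · `stub_tightBondsSuperExp` (L in Lean, provable now; THIS CARD's statics price) ·
`stub_cageDichotomy` (L–XL; THIS CARD's lever) · `stub_dispersedNoReconcentration` (XL, hardest, residual).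
`DiffuseBackwardInfluence_of (hT : TransferIsometry) : DiffuseBackwardInfluence` is the kernel-checked composition
(real proof; `sorry` only inside the six `stub_*`): thresholds `σ₀ := min …`, the four-strata union bound
(`eqSuperExpDelocalisation_of_strata`, proved), transport of the time-`(t−Δ_N)` event by invariance
(`measure_setOf_comp_le_of_le`, proved), `0 ≤ ipr ≤ 9` from the row budget (`avg_ipr_le_nine`, proved;
`rowBudget_of_transferIsometry` matches the route item with the landed vocabulary by ζ/δ-reduction), then S2 with
`F_N z := ipr σ N (Φ_{t−Δ_N} z) Δ_N`, `B := 9`.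

## Disproof used (Cruxes/DiffuseBackwardInfluence/Disproof.lean, cycle 1; landed Negative/{TransferKernels,FreeDirection})
* F5 `one_le_ipr_of_planar` / F7 `one_le_rowIpr_of_free_direction` = the `_false_without_<normal non-degeneracy>`
  content: honoured by S6, whose event EXCLUDES configurations with `≥ δ'(N+1)` undispersed active particles; checked
  here: `undispersed_of_orth` (own normals ⊥ a unit `e` ⇒ `Λ`-undispersed for every `Λ > 0`) and
  `strata_cover_of_allUndispersed` (if every particle is undispersed, the three strata counts sum to `≥ N+1`, so a
  planar window is never in the residual event once `δ' ≤ 1/3`).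
* F3 `nine_mul_idleFrac_le_ipr` / F7 `lowCollFrac_le_ipr` (collision poverty is load-bearing): honoured by S3/POOR —
  `poor_of_noOwnStep` (no own step ⇒ counted poor for every `m`).
* F4 `step_step` (no pathwise monotone functional): nothing here is pathwise; every stub is a statement about the MEASURE
  `eqLaw` (S3–S6) or the entropy transfer (S2).
* F1/F2: `Δ_N → 0` is carried but never used at equilibrium; F3 (growth necessary): used — `AdmissibleWindow` keeps
  `Δ_N (N+1)^{1/3} → ∞` and the tightness scale is tied to it (`TightnessScale`).
* Triage r1-2 Appendix B (the ideator's `TouchingPairsLD` has the wrong slope `δ` for touching PARTICLES): S4 is stated in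
  the slope-free form the composition consumes (gap `ρ_N → 0`, any fixed fraction `δ`, every rate `c`), true with slope
  `δ/2` (dimers) and proved-on-paper by matching extraction (docstring of S4).
* Triage r1-3 (trap list = free direction ∪ right-angled; the card covers only the degeneracy stratum): dispersion is
  the quantitative free-direction functional; right-angled COLLECTIVE traps are tight-or-loose positional structures —
  tight ones sit in BOND (S4), loose ones rattle-disperse in every direction and are handed, dispersed, to S6 (said so).
-/

namespace Summit.AtomisticToContinuum.HydrodynamicLimit.Cruxes.DiffuseBackwardInfluence.CagedStratumPricing

open scoped BigOperators Topology ENNReal InnerProductSpace Classical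
open Filter Set MeasureTheory
open Literature.Analysis.FluidPDE Literature.MathematicalPhysics.KineticTheory
open Summit.AtomisticToContinuum.HydrodynamicLimit.Theses.CollisionIsometryCLT
open Summit.AtomisticToContinuum.HydrodynamicLimit.Theorems.DiffuseBackwardInfluenceNeg

noncomputable section

/-! ## Vocabulary (on top of the landed `pre` / `pairsAt` / `step` / `colls` / `transfer` / `rowIpr` / `ipr` / `normalAt`) -/

/-- Hard-sphere flows of `N + 1` spheres of diameter `hsDiameter σ N` on `𝕋³`. -/
abbrev Flow (σ : ℝ) (N : ℕ) : Type :=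
  HardSphereFlow (Torus.geometry (Fin 3)) (hsDiameter σ N) (N + 1)

/-- The HOMOGENEOUS Gibbs law at rest with unit density and temperature, `localGibbsLaw σ 1 0 1` — the invariant
reference law (`G_N`). -/
def eqLaw (σ : ℝ) (N : ℕ) (Φ : Flow σ N) : Measure (Cfg N) :=
  localGibbsLaw σ (fun _ => 1) (fun _ => 0) (fun _ => 1) N Φ

/-- Fold step `k` TOUCHES particle `i`: `i` is an endpoint of the reflected pair `h.some` (the very pair the crux's
fold reflects; same predicate as the sibling lines' `collOf` / `ownColl`). -/
def OwnStep (σ : ℝ) (N : ℕ) (y : Cfg N) (k : ℕ) (i : Fin (N + 1)) : Prop :=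
  ∃ h : (pairsAt σ N y k).Nonempty, h.some.1 = i ∨ h.some.2 = i

/-- The own collision steps of particle `i` in the window `[0, Δ]` (steps `k < colls` touching `i`). -/
def ownSteps (σ : ℝ) (N : ℕ) (y : Cfg N) (Δ : ℝ) (i : Fin (N + 1)) : Finset ℕ :=
  (Finset.range (colls σ N y Δ)).filter (fun k => OwnStep σ N y k i)

/-- The own-collision count of particle `i` in the window. -/
def ownColl (σ : ℝ) (N : ℕ) (y : Cfg N) (Δ : ℝ) (i : Fin (N + 1)) : ℕ :=
  (ownSteps σ N y Δ i).card

/-- POOR stratum size: the number of particles with at most `m` own collisions in the window. -/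
def poorCount (σ : ℝ) (N : ℕ) (y : Cfg N) (Δ : ℝ) (m : ℕ) : ℕ :=
  (Finset.univ.filter (fun i : Fin (N + 1) => ownColl σ N y Δ i ≤ m)).card

/-- The realised UNIT normal of step `k` (`0` if the step reflects nothing). -/
def unitNormalAt (σ : ℝ) (N : ℕ) (y : Cfg N) (k : ℕ) : EuclideanSpace ℝ (Fin 3) :=
  ‖normalAt σ N y k‖⁻¹ • normalAt σ N y k

/-- NORMAL SPREAD of particle `i` along a direction `e`: the accumulated squared `e`-component of `i`'s own unit
normals over the window, `Σ_{own k} ⟪ω̂_k, e⟫²` (the quadratic form of the own-normal scatter matrix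
`S_i = Σ ω̂_k ω̂_kᵀ`; its minimum over unit `e` is `λ_min(S_i)`, the quantitative negation of a free direction). -/
def normalSpread (σ : ℝ) (N : ℕ) (y : Cfg N) (Δ : ℝ) (i : Fin (N + 1)) (e : EuclideanSpace ℝ (Fin 3)) : ℝ :=
  ∑ k ∈ ownSteps σ N y Δ i, ⟪unitNormalAt σ N y k, e⟫_ℝ ^ 2

/-- Particle `i` is `Λ`-UNDISPERSED on the window: some unit direction carries accumulated squared own-normal
component `< Λ` (a `Λ`-approximate free direction; `Λ = 0⁺` is the planar / `≤ 2`-collision kernel of the Disproof). -/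
def Undispersed (σ : ℝ) (N : ℕ) (y : Cfg N) (Δ Λ : ℝ) (i : Fin (N + 1)) : Prop :=
  ∃ e : EuclideanSpace ℝ (Fin 3), ‖e‖ = 1 ∧ normalSpread σ N y Δ i e < Λ

/-- Particle `i` is `ρ`-BONDED in the configuration `y`: another centre lies within minimal-image distance
`(1 + ρ) ε`, `ε = hsDiameter σ N` (gap `≤ ρ ε`; a tightly caged sphere has `≥ 3` such bonds, one suffices here). -/
def Bonded (σ : ℝ) (N : ℕ) (ρ : ℝ) (y : Cfg N) (i : Fin (N + 1)) : Prop :=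
  ∃ j : Fin (N + 1), j ≠ i ∧ Torus.euclidDist (y i).1 (y j).1 ≤ (1 + ρ) * hsDiameter σ N

/-- BOND stratum size: the number of `ρ`-bonded particles. -/
def bondCount (σ : ℝ) (N : ℕ) (ρ : ℝ) (y : Cfg N) : ℕ :=
  (Finset.univ.filter (fun i : Fin (N + 1) => Bonded σ N ρ y i)).card

/-- LOOSE-DEGENERATE stratum size: particles that are ACTIVE (`> m` own collisions), `Λ`-UNDISPERSED, and NOT
`ρ`-bonded at the window start — the stratum the cage dichotomy (S5) says is super-exponentially thin. -/
def looseDegCount (σ : ℝ) (N : ℕ) (y : Cfg N) (Δ : ℝ) (m : ℕ) (Λ ρ : ℝ) : ℕ :=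
  (Finset.univ.filter (fun i : Fin (N + 1) =>
    m < ownColl σ N y Δ i ∧ Undispersed σ N y Δ Λ i ∧ ¬ Bonded σ N ρ y i)).card

/-- Admissible window sequence (the crux's three hypotheses): `Δ_N > 0`, `Δ_N → 0`, `Δ_N (N+1)^{1/3} → ∞`
(`n_N ≍ σ² Δ_N (N+1)^{1/3} → ∞` mean free times). -/
def AdmissibleWindow (Δ : ℕ → ℝ) : Prop :=
  (∀ N, 0 < Δ N) ∧ Tendsto Δ atTop (𝓝 0) ∧
    Tendsto (fun N : ℕ => Δ N * ((N + 1 : ℕ) : ℝ) ^ ((1 : ℝ) / 3)) atTop atTop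

/-- Admissible TIGHTNESS SCALE for the window: `ρ_N > 0`, `ρ_N → 0` (so tight bonds are super-exponentially priced
by statics) and `ρ_N · Δ_N (N+1)^{1/3} → ∞` (so cages with gap `> ρ_N ε` rattle `≫ (gap)⁻²`-many times:
`ρ_N ≫ σ³/n_N`, the card's tightness threshold `r ≲ ε √2π σ³ / n_N`). -/
def TightnessScale (Δ ρ : ℕ → ℝ) : Prop :=
  (∀ N, 0 < ρ N) ∧ Tendsto ρ atTop (𝓝 0) ∧
    Tendsto (fun N : ℕ => ρ N * (Δ N * ((N + 1 : ℕ) : ℝ) ^ ((1 : ℝ) / 3))) atTop atTop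

/-- A family of configuration events `E_N` is SUPER-EXPONENTIALLY RARE under the homogeneous law at `σ`: for every
rate `c`, eventually in `N`, `G_N(E_N) ≤ e^{−c (N+1)}` (the flow `Φ` is a dummy parameter of `localGibbsLaw`). -/
def SuperExpRare (σ : ℝ) (E : (N : ℕ) → Set (Cfg N)) : Prop :=
  ∀ c : ℝ, ∀ᶠ N : ℕ in atTop, ∀ Φ : Flow σ N,
    eqLaw σ N Φ (E N) ≤ ENNReal.ofReal (Real.exp (-(c * ((N + 1 : ℕ) : ℝ))))

/-! ## The statements of the line (all at a fixed reduced density `σ`) -/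

/-- Invariance of `G_N` under every flow map (consumed form of S1 at `θe = 1`). -/
def EqInvariantAt (σ : ℝ) : Prop :=
  ∀ (N : ℕ) (Φ : Flow σ N) (s : ℝ), MeasurePreserving (Φ.flow s) (eqLaw σ N Φ) (eqLaw σ N Φ)

/-- The row budget of the transfer in the landed vocabulary: `Σₖ Σₐ ‖M (eₖ ⊗ eₐ) i‖² = 3` for every row `i`
(the fourth conjunct of the route support item `TransferIsometry`, stmt-AtomisticToContinuum-12951). -/
def RowBudgetAt (σ : ℝ) : Prop :=
  ∀ (N : ℕ) (y : Cfg N) (Δ : ℝ) (i : Fin (N + 1)),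
    ∑ k : Fin (N + 1), ∑ a : Fin 3, ‖transfer σ N y Δ (Pi.single k (EuclideanSpace.single a (1 : ℝ))) i‖ ^ 2 = 3

/-- S3 statement. FEW-COLLISION PARTICLES ARE SUPER-EXPONENTIALLY RARE: for every admissible window and fraction
`δ > 0` there is a divergent activity threshold `m_N → ∞` such that `G_N{≥ δ(N+1) particles have ≤ m_N own collisions
in [0, Δ_N]}` is super-exponentially rare. -/
def FewCollisionsSuperExpAt (σ : ℝ) : Prop :=
  ∀ Δ : ℕ → ℝ, AdmissibleWindow Δ → ∀ δ : ℝ, 0 < δ →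
    ∃ m : ℕ → ℕ, Tendsto m atTop atTop ∧
      SuperExpRare σ (fun N => {y | δ * ((N + 1 : ℕ) : ℝ) ≤ (poorCount σ N y (Δ N) (m N) : ℝ)})

/-- S4 statement. TIGHT BONDS ARE SUPER-EXPONENTIALLY RARE (statics): for every gap scale `ρ_N > 0` with `ρ_N → 0`
and every fraction `δ > 0`, `G_N{≥ δ(N+1) particles have a neighbour within centre distance (1+ρ_N) ε}` is
super-exponentially rare. -/
def TightBondsSuperExpAt (σ : ℝ) : Prop :=
  ∀ ρ : ℕ → ℝ, (∀ N, 0 < ρ N) → Tendsto ρ atTop (𝓝 0) → ∀ δ : ℝ, 0 < δ →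
    SuperExpRare σ (fun N => {y | δ * ((N + 1 : ℕ) : ℝ) ≤ (bondCount σ N (ρ N) y : ℝ)})

/-- S5 statement. THE CAGE DICHOTOMY: for every admissible window, every divergent activity threshold `m_N → ∞` and
every `δ > 0` there are a tightness scale `ρ_N` (admissible: `→ 0`, `ρ_N Δ_N (N+1)^{1/3} → ∞`) and a dispersion
threshold `Λ_N → ∞` such that `G_N{≥ δ(N+1) particles are active (> m_N own collisions), Λ_N-undispersed and not
ρ_N-bonded at the window start}` is super-exponentially rare — persistent degeneracy off tight cages does not happen. -/
def CageDichotomyAt (σ : ℝ) : Prop :=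
  ∀ Δ : ℕ → ℝ, AdmissibleWindow Δ → ∀ m : ℕ → ℕ, Tendsto m atTop atTop → ∀ δ : ℝ, 0 < δ →
    ∃ ρ : ℕ → ℝ, TightnessScale Δ ρ ∧ ∃ Λ : ℕ → ℝ, Tendsto Λ atTop atTop ∧
      SuperExpRare σ (fun N => {y | δ * ((N + 1 : ℕ) : ℝ) ≤ (looseDegCount σ N y (Δ N) (m N) (Λ N) (ρ N) : ℝ)})

/-- S6 statement. NO RECONCENTRATION AMONG ACTIVE DISPERSED PARTICLES (the residual): for every admissible window and
`δ > 0` there is `δ' > 0` such that for all divergent thresholds `m_N → ∞`, `Λ_N → ∞` and every admissible tightness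
scale `ρ_N`, `G_N{δ < ipr ∧ poorCount(m_N) < δ'(N+1) ∧ bondCount(ρ_N) < δ'(N+1) ∧ looseDegCount(m_N, Λ_N, ρ_N) < δ'(N+1)}`
is super-exponentially rare. -/
def DispersedNoReconcentrationAt (σ : ℝ) : Prop :=
  ∀ Δ : ℕ → ℝ, AdmissibleWindow Δ → ∀ δ : ℝ, 0 < δ → ∃ δ' : ℝ, 0 < δ' ∧
    ∀ m : ℕ → ℕ, Tendsto m atTop atTop → ∀ Λ : ℕ → ℝ, Tendsto Λ atTop atTop →
    ∀ ρ : ℕ → ℝ, TightnessScale Δ ρ →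
      SuperExpRare σ (fun N => {y | δ < ipr σ N y (Δ N) ∧
        (poorCount σ N y (Δ N) (m N) : ℝ) < δ' * ((N + 1 : ℕ) : ℝ) ∧
        (bondCount σ N (ρ N) y : ℝ) < δ' * ((N + 1 : ℕ) : ℝ) ∧
        (looseDegCount σ N y (Δ N) (m N) (Λ N) (ρ N) : ℝ) < δ' * ((N + 1 : ℕ) : ℝ)})

/-- The transferred crux `C⁺` at `σ` (line A's currency, triage r1-1 sharpening: speed `≫ N`, no fixed rate):
for every admissible window and `δ > 0`, `G_N{δ < ipr(·, Δ_N)}` is super-exponentially rare. -/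
def EqSuperExpDelocalisationAt (σ : ℝ) : Prop :=
  ∀ Δ : ℕ → ℝ, AdmissibleWindow Δ → ∀ δ : ℝ, 0 < δ →
    SuperExpRare σ (fun N => {y | δ < ipr σ N y (Δ N)})

/-! ## Registered stubs -/

/-- STUB 1 (size S–M, provable-now; VERBATIM the shared support item `GibbsInvariance` stmt-AtomisticToContinuum-9239 and
the `ballistic-tubes` stub of the same name — two sorry-free candidate proofs are attached to 9239; sources: Alexander1975,
CIP1994 §4.2; in tree `HardSphereFlow.measurePreserving` (Liouville), `IsHardSphereTrajectory.configEnergy_eq_holds`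
(energy), `good_subset` / `mapsTo_good` / `measure_compl_good`). **Gibbs invariance.** For every `σ, θe > 0, N`, every
hard-sphere flow `Φ` and every `t`, the flow map `Φ_t` preserves the homogeneous canonical law
`localGibbsLaw σ 1 0 θe N Φ`. Used at `θe = 1` (`EqInvariantAt`). -/
theorem stub_gibbsInvariance :
    ∀ (σ θe : ℝ) (N : ℕ) (Φ : Literature.Analysis.FluidPDE.HardSphereFlow (Literature.Analysis.FluidPDE.Torus.geometry (Fin 3)) (Literature.MathematicalPhysics.KineticTheory.hsDiameter σ N) (N + 1)) (t : ℝ), 0 < θe → MeasureTheory.MeasurePreserving (Φ.flow t) (Literature.MathematicalPhysics.KineticTheory.localGibbsLaw σ (fun _ => 1) (fun _ => 0) (fun _ => θe) N Φ) (Literature.MathematicalPhysics.KineticTheory.localGibbsLaw σ (fun _ => 1) (fun _ => 0) (fun _ => θe) N Φ) := by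
  sorry

/-- STUB 2 (size M; VERBATIM the `ballistic-tubes` stub `stub_entropyTransfer` — one proof closes both; sources:
KipnisLandim1999 App. 1 Prop. 8.2 p. 338 = tree fact `Literature.Probability.Entropy.KipnisLandim1999_A1_8_2_holds`
(PROVED), the `O(N)` budget `H(localGibbsLaw σ a₀ u₀ θ₀ | localGibbsLaw σ 1 0 1) ≤ C(N+1)` = shared support item
FrostBudget stmt-AtomisticToContinuum-9237 (Gaussian log-ratio + `log Z_G/Z_LG ≤ (N+1) log(1/inf a₀)`),
`isProbabilityMeasure_localGibbsLaw` (σ ≤ 1/2), `localGibbsLaw_absolutelyContinuous`, GuoPapanicolaouVaradhan1988 eq. (2.3)).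
**Entropy transfer for bounded functionals.** For continuous positive profiles there is `σ₀ > 0` such that for
`0 < σ < σ₀`, every flow family and every family of functionals `0 ≤ F_N ≤ B` of the initial configuration: if for every
`δ > 0` the events `{δ < F_N}` are super-exponentially rare under the homogeneous law (`≤ e^{−c(N+1)}` for every `c`,
eventually), then `∫ F_N d(localGibbsLaw σ a₀ u₀ θ₀ N (Φ N)) → 0`. Proof sketch: `P(A) ≤ P(A') ≤ (log 2 + C(N+1)) /
log(1 + 1/G(A')) ≤ 2C/c` with `A' = toMeasurable G A` (no measurability of `F` needed), `∫⁻ F ≤ δ + B·P{δ < F}`. -/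
theorem stub_entropyTransfer :
    ∀ (a₀ θ₀ : (UnitAddTorus (Fin 3)) → ℝ) (u₀ : (UnitAddTorus (Fin 3)) → (EuclideanSpace ℝ (Fin 3))), Continuous a₀ → Continuous θ₀ → Continuous u₀ → (∀ x, 0 < a₀ x) → (∀ x, 0 < θ₀ x) → ∃ σ₀ : ℝ, 0 < σ₀ ∧ ∀ σ : ℝ, 0 < σ → σ < σ₀ → ∀ Φ : (N : ℕ) → Literature.Analysis.FluidPDE.HardSphereFlow (Literature.Analysis.FluidPDE.Torus.geometry (Fin 3)) (Literature.MathematicalPhysics.KineticTheory.hsDiameter σ N) (N + 1), ∀ (F : (N : ℕ) → Literature.Analysis.FluidPDE.Config (N + 1) (Fin 3) (UnitAddTorus (Fin 3)) → ℝ) (B : ℝ), (∀ N z, 0 ≤ F N z) → (∀ N z, F N z ≤ B) → (∀ δ : ℝ, 0 < δ → ∀ c : ℝ, ∀ᶠ N : ℕ in atTop, Literature.MathematicalPhysics.KineticTheory.localGibbsLaw σ (fun _ => 1) (fun _ => 0) (fun _ => 1) N (Φ N) {z : Literature.Analysis.FluidPDE.Config (N + 1) (Fin 3) (UnitAddTorus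 (Fin 3)) | δ < F N z} ≤ ENNReal.ofReal (Real.exp (-(c * ((N + 1 : ℕ) : ℝ))))) → Tendsto (fun N : ℕ => ∫⁻ z, ENNReal.ofReal (F N z) ∂(Literature.MathematicalPhysics.KineticTheory.localGibbsLaw σ a₀ u₀ θ₀ N (Φ N))) atTop (𝓝 0) := by
  sorry

/-- STUB 3 (size L; shared content with `superexp-entropy-transfer` (`stub_fewCollisionsSuperExp`) and `ballistic-tubes`
(`stub_tubeNonCrossingLD` + `stub_fewCollisionsOfTubes`, which give the fixed-`m` form for every `m`; a diagonal
extraction then yields `m_N → ∞`); sources: the `ballistic-tubes` card (pigeonhole over `m+1` slots + stationarity reduce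
to a STATIC tube-separation event whose Gibbs cost is velocity coherence `≈ 3(δ/m)(N+1) log(n_N/m)` — super-exponential
with margin `log n_N`), barrier note N3 (vacuum cannot hide a positive fraction), CIP1994 App. 4.A, TRIAGE-r1-1).
**Few collisions are super-exponentially rare** (`FewCollisionsSuperExpAt σ` for all small `σ`).
Why it might fail: only through an `e^{−O(N)}`-cost velocity–position pattern of `δ(N+1)` mutually non-colliding
particles lasting `n_N/m_N → ∞` free times; all known patterns cost `≥ δ' N log n_N`.
NECESSARY for the crux by the landed `fewLowColl_of_diffuseBackwardInfluence` (in mean), so no line avoids it. -/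
theorem stub_fewCollisionsSuperExp :
    ∃ σ₀ : ℝ, 0 < σ₀ ∧ ∀ σ : ℝ, 0 < σ → σ < σ₀ → FewCollisionsSuperExpAt σ := by
  sorry

/-- STUB 4 (size L in Lean, PROVABLE NOW — this card's statics price; sources: card `caged-stratum-pricing`
(`TouchingPairsLD`), TRIAGE-r1-2 Appendix B (correct slope: `δ/2` for bonded PARTICLES, `δ` for BONDS), Ruelle1969 §3
(low-density bounds), tree: `localGibbsLaw` / `canonicalDensity` / `particleLaw` (HardSphereEuler, HardSphereTorusMeasure),
`hsFreeVolume`-type `e^{O(N)}` hard-core conditioning, `Torus.euclidDist`, `reprSym`).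
**Tight bonds are super-exponentially rare** (`TightBondsSuperExpAt σ` for all small `σ`): for `ρ_N → 0` and fixed
`δ > 0`, `G_N{≥ δ(N+1) particles with a neighbour within (1+ρ_N)ε} ≤ e^{−c(N+1)}` for every `c`, eventually.
Proof route (paper-complete): the bonded particles span a contact graph of maximal degree `≤ 63` (hard core: centres
within `(1+ρ)ε ≤ 3ε/2` of a given centre), so they contain `≥ δ(N+1)/128 =: M` DISJOINT bonded pairs; union over the
`≤ (N+1)^{2M}/M!` choices; under the ideal gas conditioned on the hard core (conditioning costs `e^{O(N)}` at small σ)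
each prescribed pair lies in the contact SHELL of volume `(4π/3)ε³((1+ρ)³ − 1) ≤ 8πρε³ = 8πρσ³/(N+1)`; total
`≤ e^{C(N+1)} (8πe ρ_N σ³ (N+1)/M)^M = exp(−(N+1)(δ/128)(log(1/ρ_N) − C')) ≤ e^{−c(N+1)}` eventually since
`log(1/ρ_N) → ∞`. Why it might fail: it does not at small σ (mean bonded fraction `≈ 4πσ³ρ_N g₂ → 0`); only the
`e^{O(N)}` conditioning constant needs `σ` below the free-volume threshold, whence `∃ σ₀`. -/
theorem stub_tightBondsSuperExp :
    ∃ σ₀ : ℝ, 0 < σ₀ ∧ ∀ σ : ℝ, 0 < σ → σ < σ₀ → TightBondsSuperExpAt σ := by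
  sorry

/-- STUB 5 — LOAD-BEARING FOR THIS IDEA (size L–XL; sources: card `caged-stratum-pricing` (rattling escape: tilt `≍ ρ`
per bounce, `≍ n_N ℓ/(ρε)` bounces, tightness threshold `ρ ≍ σ³/n_N`, coherent tilts drift linearly — TRIAGE-r1-3),
TRIAGE-r1-3 sharpening (trap list = free direction ∪ right-angled; planar families), Disproof F5/F7 (the kernels this stub
prices), SinaiChernov1987 / Simanyi2013 (dispersing instability of repeated bounces on a convex scatterer: transverse
deviations grow by `1 + 2ρ` per bounce, so `η`-coherent rattling for `M` bounces costs velocity precision `e^{−2Mρ}`,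
`Mρ ≍ n_N ℓ/ε → ∞`), BuragoFerlegerKononenko1998 doi:10.2307/120962 (an ISOLATED `K`-cluster collides `≤ f(K)` times:
activity inside a cage needs confinement by the gas, i.e. persistence, i.e. bonds at a slot time), the share card's
one-flight non-degeneracy (gas phase: `m_N` chance-coplanar arrivals cost `≥ (m_N − 2) log(1/Cη)` each), kit j007601 R1
(no plateau at φ = 0.45)). **Cage dichotomy** (`CageDichotomyAt σ` for small `σ`, GIVEN invariance, the tight-bond statics
S4 at every time and the few-collisions bound S3 as tools): with `ρ_N := (Δ_N (N+1)^{1/3})^{−1/2}` (say) and a slowly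
divergent `Λ_N`, a positive fraction of particles that are active, `Λ_N`-undispersed (some direction `e` with
`Σ_{own k} ⟪ω̂_k, e⟫² < Λ_N`) and not `ρ_N`-bonded at the window start is super-exponentially rare under `G_N`: such a
particle is either (i) in the gas phase — `m_N → ∞` own normals from one-flight-random partners, all nearly ⊥ `e`:
chance, super-exponential in aggregate; (ii) in a LOOSE cage (gap `> ρ_N ε` throughout) — it bounces `≳ n_N ℓ/(gap·ε)`
times with incoherent tilts `≍ gap`, so `Σ⟪ω̂_k, e⟫² ≳ n_N ℓ ρ_N/ε → ∞ ≥ Λ_N` for EVERY `e` unless the rattling phases are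
coherent (velocity fine-tuning, super-exponential by dispersing instability); (iii) in a cage that is tight at some slot
time although unbonded at the start — priced by S4 at that time via invariance; (iv) in a sheet / two-bond channel
(planar kernel) — persistence needs the conserved out-of-plane velocity components to vanish to precision
`ηε/Δ_N`: velocity coherence, super-exponential. A statement about collision GEOMETRY only (no transfer).
Why it might fail: an `e^{−O(N)}`-cheap, persistent, UNBONDED structure whose members' own normals stay `Λ`-coplanar
through `m_N → ∞` collisions without velocity fine-tuning — none known (sheets need fine-tuning by F5's conservation law;
loose cages tilt); or a failure of the aggregate decorrelation in (i) (the share card's open one-flight bound). -/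
theorem stub_cageDichotomy :
    ∃ σ₀ : ℝ, 0 < σ₀ ∧ ∀ σ : ℝ, 0 < σ → σ < σ₀ →
      EqInvariantAt σ → TightBondsSuperExpAt σ → FewCollisionsSuperExpAt σ → CageDichotomyAt σ := by
  sorry

/-- STUB 6 — HARDEST, the residual (size XL; NOT this idea's lever; sources: the sibling lines' `stub_noReconcentration(SuperExp)`
(of which this is a strict weakening: two more pointwise hypotheses — few tight bonds, few loose-degenerate particles — and
three tools), crux cards `coalescing-influence-tracers` (exact two-tracer duality: what must be excluded is RE-MERGING, fed
only by host–host re-touches; `r(σ) = O(σ³)`, LateTouch → 0 by 3-D transience), `right-angle-rigidity` (loose right-angled /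
close-packed order: tilted reflections generate a dense subgroup; Benoist–de Saxcé-type equidistribution is the named tool),
`gram-coherence-cascade` (coherence subordination), TRIAGE-r1-3's equal-swap chain (the extremal re-feeding history every
proof must price), kit j007601 / j008854 (no `N`-independent plateau at φ ≤ 0.45; never-split part `e^{−0.30 n}`), Disproof F4
(no pathwise argument can do it), AldousLanoue2012 §2.4, BuragoFerlegerKononenko1998).
**No reconcentration among active dispersed particles** (`DispersedNoReconcentrationAt σ` for small `σ`, GIVEN invariance,
the tight-bond statics and the few-collisions bound as tools): super-exponentially surely under `G_N`, a configuration in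
which fewer than `δ'(N+1)` particles are collision-poor, fewer than `δ'(N+1)` are `ρ_N`-bonded and fewer than `δ'(N+1)` are
loose-degenerate — so at least `(1 − 3δ')(N+1)` particles made `> m_N → ∞` own collisions with own normals of accumulated
spread `≥ Λ_N → ∞` in EVERY direction — has `ipr ≤ δ`. Content: (a) single-particle: a dispersed own-normal sequence leaves
no `Λ`-approximate invariant direction, so the self-block and the row split geometrically unless echoed (F4); (b) collective:
re-merging of split mass needs host–host re-touch conspiracies (the chain), super-exponentially rare at the `δ'(N+1)`-particle
scale; (c) the `≤ 3δ'(N+1)` exceptional rows contribute `≤ 27δ'` to `ipr` (row budget). Why it might fail — and it kills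
THIS LINE, not the crux: an EXPONENTIAL-cost (`e^{−O(N)}`) persistent structure of active, dispersed, unbonded particles
holding `ipr > δ` — the dense ORDERED loose droplet (close-packed or right-angled at gap `≫ ρ_N ε`) if tilted-reflection
products fail to equidistribute within `n_N ℓ ρ/ε` bounces, or a re-feeding cascade from `o(N)` sources. -/
theorem stub_dispersedNoReconcentration :
    ∃ σ₀ : ℝ, 0 < σ₀ ∧ ∀ σ : ℝ, 0 < σ → σ < σ₀ →
      EqInvariantAt σ → TightBondsSuperExpAt σ → FewCollisionsSuperExpAt σ →
        DispersedNoReconcentrationAt σ := by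
  sorry

/-! ## Proved glue -/

/-- Transport of an event along a measure-preserving self-map: if `map f μ = μ` and `μ{y | p y} ≤ b` then
`μ{x | p (f x)} ≤ b` (no measurability of the event needed: `Measure.le_map_apply`). [folklore] -/
theorem measure_setOf_comp_le_of_le {α : Type*} [MeasurableSpace α] {μ : Measure α} {f : α → α}
    (hf : Measurable f) (h : Measure.map f μ = μ) {p : α → Prop} {b : ℝ≥0∞} (hb : μ {y | p y} ≤ b) :
    μ {x | p (f x)} ≤ b := by
  calc μ {x | p (f x)} = μ (f ⁻¹' {y | p y}) := rfl
    _ ≤ Measure.map f μ {y | p y} := Measure.le_map_apply hf.aemeasurable _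
    _ = μ {y | p y} := by rw [h]
    _ ≤ b := hb

/-- Row budget `3` ⇒ mean inverse participation ratio `≤ 9`: for nonnegative block weights `wᵢₖ = Σₐ Rₖₐᵢ²` with
`Σₖ wᵢₖ = 3`, `Σₖ wᵢₖ² ≤ (Σₖ wᵢₖ)² = 9`, and an average of numbers `≤ 9` is `≤ 9`. [folklore] -/
theorem avg_ipr_le_nine {n : ℕ} (R : Fin (n + 1) → Fin 3 → Fin (n + 1) → ℝ)
    (h : ∀ i, ∑ k, ∑ a, R k a i ^ 2 = 3) :
    ((n + 1 : ℕ) : ℝ)⁻¹ * ∑ i, ∑ k, (∑ a, R k a i ^ 2) ^ 2 ≤ 9 := by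
  have hrow : ∀ i : Fin (n + 1), ∑ k, (∑ a, R k a i ^ 2) ^ 2 ≤ 9 := by
    intro i
    have hw : ∀ k : Fin (n + 1), 0 ≤ ∑ a, R k a i ^ 2 := fun k => Finset.sum_nonneg fun a _ => sq_nonneg _
    calc ∑ k, (∑ a, R k a i ^ 2) ^ 2 ≤ ∑ k, (∑ a, R k a i ^ 2) * ∑ l, ∑ a, R l a i ^ 2 := by
          refine Finset.sum_le_sum fun k _ => ?_
          rw [sq]
          exact mul_le_mul_of_nonneg_left
            (Finset.single_le_sum (fun l _ => hw l) (Finset.mem_univ k)) (hw k)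
      _ = (∑ k, ∑ a, R k a i ^ 2) ^ 2 := by rw [← Finset.sum_mul, sq]
      _ = 9 := by rw [h i]; norm_num
  have hn : (0 : ℝ) < ((n + 1 : ℕ) : ℝ) := by positivity
  calc ((n + 1 : ℕ) : ℝ)⁻¹ * ∑ i, ∑ k, (∑ a, R k a i ^ 2) ^ 2
      ≤ ((n + 1 : ℕ) : ℝ)⁻¹ * ∑ _i : Fin (n + 1), (9 : ℝ) :=
        mul_le_mul_of_nonneg_left (Finset.sum_le_sum fun i _ => hrow i) (inv_nonneg.mpr hn.le)
    _ = 9 := by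
        rw [Finset.sum_const, Finset.card_univ, Fintype.card_fin, nsmul_eq_mul, ← mul_assoc,
          inv_mul_cancel₀ hn.ne', one_mul]

/-- `0 ≤ ipr` (sum of squares). [folklore] -/
theorem ipr_nonneg (σ : ℝ) (N : ℕ) (y : Cfg N) (Δ : ℝ) : 0 ≤ ipr σ N y Δ := by
  unfold ipr
  exact mul_nonneg (inv_nonneg.2 (by positivity)) (Finset.sum_nonneg fun i _ => rowIpr_nonneg σ N y Δ i)

/-- Row budget ⇒ `ipr ≤ 9`. [folklore] -/
theorem ipr_le_nine {σ : ℝ} (hB : RowBudgetAt σ) (N : ℕ) (y : Cfg N) (Δ : ℝ) : ipr σ N y Δ ≤ 9 := by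
  unfold ipr rowIpr
  exact avg_ipr_le_nine
    (fun k a i => ‖transfer σ N y Δ (Pi.single k (EuclideanSpace.single a (1 : ℝ))) i‖) (hB N y Δ)

/-- The route support item `TransferIsometry` (crux-`let` vocabulary) yields the row budget in the landed vocabulary
(fourth conjunct; the crux's `let M` and `transfer` agree by ζ/δ-reduction). [folklore] -/
theorem rowBudget_of_transferIsometry
    (hT : Summit.AtomisticToContinuum.HydrodynamicLimit.Theses.CollisionIsometryCLT.TransferIsometry) (σ : ℝ) :
    RowBudgetAt σ :=
  fun N y Δ i => (hT σ N y Δ).2.2.2 i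

/-- Arithmetic of the four-strata union bound: `4 e^{−(c+3)(N+1)} ≤ e^{−c(N+1)}` (as `e³ ≥ 4`). [folklore] -/
theorem four_mul_exp_le (c : ℝ) (N : ℕ) :
    4 * Real.exp (-((c + 3) * ((N + 1 : ℕ) : ℝ))) ≤ Real.exp (-(c * ((N + 1 : ℕ) : ℝ))) := by
  set n : ℝ := ((N + 1 : ℕ) : ℝ) with hn
  have hn1 : (1 : ℝ) ≤ n := by
    rw [hn]; exact_mod_cast Nat.succ_le_succ (Nat.zero_le N)
  have key : Real.exp (-((c + 3) * n)) = Real.exp (-(c * n)) * Real.exp (-(3 * n)) := by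
    rw [← Real.exp_add]; congr 1; ring
  rw [key]
  have h1 : Real.exp (-(3 * n)) ≤ Real.exp (-3) := Real.exp_le_exp.mpr (by nlinarith)
  have h2 : 4 * Real.exp (-3 : ℝ) ≤ 1 := by
    have h3 : (3 : ℝ) + 1 ≤ Real.exp 3 := Real.add_one_le_exp 3
    have hpos : 0 < Real.exp (3 : ℝ) := Real.exp_pos 3
    rw [Real.exp_neg]
    rw [mul_inv_le_iff₀ hpos]
    linarith
  have hpos := Real.exp_pos (-(c * n))
  calc 4 * (Real.exp (-(c * n)) * Real.exp (-(3 * n)))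
      = Real.exp (-(c * n)) * (4 * Real.exp (-(3 * n))) := by ring
    _ ≤ Real.exp (-(c * n)) * (4 * Real.exp (-3)) := by gcongr
    _ ≤ Real.exp (-(c * n)) * 1 := by gcongr
    _ = Real.exp (-(c * n)) := mul_one _

/-- The same in `ℝ≥0∞` for four summands. [folklore] -/
theorem four_superexp_le (c : ℝ) (N : ℕ) :
    ENNReal.ofReal (Real.exp (-((c + 3) * ((N + 1 : ℕ) : ℝ)))) +
        ENNReal.ofReal (Real.exp (-((c + 3) * ((N + 1 : ℕ) : ℝ)))) +
        ENNReal.ofReal (Real.exp (-((c + 3) * ((N + 1 : ℕ) : ℝ)))) +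
        ENNReal.ofReal (Real.exp (-((c + 3) * ((N + 1 : ℕ) : ℝ)))) ≤
      ENNReal.ofReal (Real.exp (-(c * ((N + 1 : ℕ) : ℝ)))) := by
  have h0 : (0 : ℝ) ≤ Real.exp (-((c + 3) * ((N + 1 : ℕ) : ℝ))) := (Real.exp_pos _).le
  rw [← ENNReal.ofReal_add h0 h0, ← ENNReal.ofReal_add (add_nonneg h0 h0) h0,
    ← ENNReal.ofReal_add (add_nonneg (add_nonneg h0 h0) h0) h0]
  apply ENNReal.ofReal_le_ofReal
  have := four_mul_exp_le c N
  linarith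

/-- THE FOUR-STRATA UNION BOUND (proved): few collisions (S3) + tight bonds (S4) + cage dichotomy (S5) + the residual
(S6), as statements at `σ`, give the transferred crux `C⁺ = EqSuperExpDelocalisationAt σ`.  Order of choices:
`δ' ← S6(Δ, δ)`, `m ← S3(Δ, δ')`, `(ρ, Λ) ← S5(Δ, m, δ')`, then for a rate `c` all four bounds at rate `c + 3` eventually,
and `{δ < ipr} ⊆ POOR ∪ BOND ∪ LOOSE-DEGENERATE ∪ RESIDUAL` by three case splits. -/
theorem eqSuperExpDelocalisation_of_strata {σ : ℝ}
    (h3 : FewCollisionsSuperExpAt σ) (h4 : TightBondsSuperExpAt σ)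
    (h5 : CageDichotomyAt σ) (h6 : DispersedNoReconcentrationAt σ) :
    EqSuperExpDelocalisationAt σ := by
  intro Δ hΔ δ hδ c
  obtain ⟨δ', hδ', H6⟩ := h6 Δ hΔ δ hδ
  obtain ⟨m, hm, H3⟩ := h3 Δ hΔ δ' hδ'
  obtain ⟨ρ, hρ, Λ, hΛ, H5⟩ := h5 Δ hΔ m hm δ' hδ'
  have H4 := h4 ρ hρ.1 hρ.2.1 δ' hδ'
  have H6' := H6 m hm Λ hΛ ρ hρ
  filter_upwards [H3 (c + 3), H4 (c + 3), H5 (c + 3), H6' (c + 3)] with N h3N h4N h5N h6N Φ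
  -- names for the four strata
  set A : Set (Cfg N) := {y | δ' * ((N + 1 : ℕ) : ℝ) ≤ (poorCount σ N y (Δ N) (m N) : ℝ)} with hA
  set B : Set (Cfg N) := {y | δ' * ((N + 1 : ℕ) : ℝ) ≤ (bondCount σ N (ρ N) y : ℝ)} with hB
  set C : Set (Cfg N) :=
    {y | δ' * ((N + 1 : ℕ) : ℝ) ≤ (looseDegCount σ N y (Δ N) (m N) (Λ N) (ρ N) : ℝ)} with hC
  set D : Set (Cfg N) := {y | δ < ipr σ N y (Δ N) ∧
      (poorCount σ N y (Δ N) (m N) : ℝ) < δ' * ((N + 1 : ℕ) : ℝ) ∧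
      (bondCount σ N (ρ N) y : ℝ) < δ' * ((N + 1 : ℕ) : ℝ) ∧
      (looseDegCount σ N y (Δ N) (m N) (Λ N) (ρ N) : ℝ) < δ' * ((N + 1 : ℕ) : ℝ)} with hD
  have hAN : eqLaw σ N Φ A ≤ ENNReal.ofReal (Real.exp (-((c + 3) * ((N + 1 : ℕ) : ℝ)))) := h3N Φ
  have hBN : eqLaw σ N Φ B ≤ ENNReal.ofReal (Real.exp (-((c + 3) * ((N + 1 : ℕ) : ℝ)))) := h4N Φ
  have hCN : eqLaw σ N Φ C ≤ ENNReal.ofReal (Real.exp (-((c + 3) * ((N + 1 : ℕ) : ℝ)))) := h5N Φ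
  have hDN : eqLaw σ N Φ D ≤ ENNReal.ofReal (Real.exp (-((c + 3) * ((N + 1 : ℕ) : ℝ)))) := h6N Φ
  have hsub : {y : Cfg N | δ < ipr σ N y (Δ N)} ⊆ A ∪ B ∪ C ∪ D := by
    intro y hy
    simp only [Set.mem_union, hA, hB, hC, hD, Set.mem_setOf_eq]
    simp only [Set.mem_setOf_eq] at hy
    by_cases hp : δ' * ((N + 1 : ℕ) : ℝ) ≤ (poorCount σ N y (Δ N) (m N) : ℝ)
    · exact Or.inl (Or.inl (Or.inl hp))
    by_cases hb : δ' * ((N + 1 : ℕ) : ℝ) ≤ (bondCount σ N (ρ N) y : ℝ)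
    · exact Or.inl (Or.inl (Or.inr hb))
    by_cases hu : δ' * ((N + 1 : ℕ) : ℝ) ≤ (looseDegCount σ N y (Δ N) (m N) (Λ N) (ρ N) : ℝ)
    · exact Or.inl (Or.inr hu)
    exact Or.inr ⟨hy, not_le.1 hp, not_le.1 hb, not_le.1 hu⟩
  calc eqLaw σ N Φ {y | δ < ipr σ N y (Δ N)}
      ≤ eqLaw σ N Φ (A ∪ B ∪ C ∪ D) := measure_mono hsub
    _ ≤ eqLaw σ N Φ (A ∪ B ∪ C) + eqLaw σ N Φ D := measure_union_le _ _
    _ ≤ (eqLaw σ N Φ (A ∪ B) + eqLaw σ N Φ C) + eqLaw σ N Φ D :=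
        add_le_add (measure_union_le _ _) le_rfl
    _ ≤ ((eqLaw σ N Φ A + eqLaw σ N Φ B) + eqLaw σ N Φ C) + eqLaw σ N Φ D :=
        add_le_add (add_le_add (measure_union_le _ _) le_rfl) le_rfl
    _ ≤ ENNReal.ofReal (Real.exp (-((c + 3) * ((N + 1 : ℕ) : ℝ)))) +
          ENNReal.ofReal (Real.exp (-((c + 3) * ((N + 1 : ℕ) : ℝ)))) +
          ENNReal.ofReal (Real.exp (-((c + 3) * ((N + 1 : ℕ) : ℝ)))) +
          ENNReal.ofReal (Real.exp (-((c + 3) * ((N + 1 : ℕ) : ℝ)))) :=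
        add_le_add (add_le_add (add_le_add hAN hBN) hCN) hDN
    _ ≤ ENNReal.ofReal (Real.exp (-(c * ((N + 1 : ℕ) : ℝ)))) := four_superexp_le c N

/-- The crux's conclusion at fixed `(σ, profiles, flow family)`, in the landed vocabulary (literally the tail of
`DiffuseBackwardInfluence` after its `∃ σ₀ ∀ σ < σ₀` prefix). -/
def CruxConclusionAt (σ : ℝ) (a₀ θ₀ : UnitAddTorus (Fin 3) → ℝ) (u₀ : UnitAddTorus (Fin 3) → EuclideanSpace ℝ (Fin 3)) (Φ : (N : ℕ) → Flow σ N) : Prop :=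
  ∀ Δ : ℕ → ℝ, (∀ N, 0 < Δ N) → Tendsto Δ atTop (𝓝 0) →
    Tendsto (fun N : ℕ => Δ N * ((N + 1 : ℕ) : ℝ) ^ ((1 : ℝ) / 3)) atTop atTop →
    ∀ t : ℝ, 0 < t →
      Tendsto (fun N : ℕ => ∫⁻ z, ENNReal.ofReal (ipr σ N ((Φ N).flow (t - Δ N) z) (Δ N))
        ∂(localGibbsLaw σ a₀ u₀ θ₀ N (Φ N))) atTop (𝓝 0)

/-- THE ENTROPY-TRANSFER STEP (proved from the statements): invariance + row budget + the transferred crux `C⁺` at `σ`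
+ the bounded-functional entropy transfer at `(σ, profiles, Φ)` give the crux's conclusion at `(σ, profiles, Φ)`, with
`F_N z := ipr σ N (Φ_{t−Δ_N} z) Δ_N`, `B := 9`. -/
theorem cruxConclusion_of {σ : ℝ} {a₀ θ₀ : UnitAddTorus (Fin 3) → ℝ} {u₀ : UnitAddTorus (Fin 3) → EuclideanSpace ℝ (Fin 3)} {Φ : (N : ℕ) → Flow σ N}
    (hInv : EqInvariantAt σ) (hB : RowBudgetAt σ) (hE : EqSuperExpDelocalisationAt σ)
    (hTr : ∀ (F : (N : ℕ) → Cfg N → ℝ) (B : ℝ), (∀ N z, 0 ≤ F N z) → (∀ N z, F N z ≤ B) →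
      (∀ δ : ℝ, 0 < δ → ∀ c : ℝ, ∀ᶠ N : ℕ in atTop,
        eqLaw σ N (Φ N) {z : Cfg N | δ < F N z} ≤ ENNReal.ofReal (Real.exp (-(c * ((N + 1 : ℕ) : ℝ))))) →
      Tendsto (fun N : ℕ => ∫⁻ z, ENNReal.ofReal (F N z) ∂(localGibbsLaw σ a₀ u₀ θ₀ N (Φ N))) atTop (𝓝 0)) :
    CruxConclusionAt σ a₀ θ₀ u₀ Φ := by
  intro Δ hΔpos hΔ0 hΔinf t ht
  refine hTr (fun N z => ipr σ N ((Φ N).flow (t - Δ N) z) (Δ N)) 9 (fun N z => ipr_nonneg σ N _ _)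
    (fun N z => ipr_le_nine hB N _ _) (fun δ hδ c => ?_)
  filter_upwards [hE Δ ⟨hΔpos, hΔ0, hΔinf⟩ δ hδ c] with N hN
  exact measure_setOf_comp_le_of_le ((Φ N).measurable_flow (t - Δ N)) (hInv N (Φ N) (t - Δ N)).map_eq (hN (Φ N))

/-! ## The composition: `TransferIsometry` (route support, by name) and the six stubs give the crux BY NAME -/

/-- **`DiffuseBackwardInfluence` from the line `caged-stratum-pricing`.** Kernel-checked bookkeeping: fix profiles;
`σ₀ := min (min σ₂ σ₃) (min (min σ₄ σ₅) (min σ₆ ½))` from stubs 2–6; for `σ < σ₀`: invariance at `θe = 1` (stub 1),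
tight bonds (stub 4) and few collisions (stub 3) feed the cage dichotomy (stub 5) and the residual (stub 6); the
four-strata union bound gives `C⁺` (`eqSuperExpDelocalisation_of_strata`); the row budget comes from `TransferIsometry`
(stmt-AtomisticToContinuum-12951, provable-now) BY NAME; the entropy transfer (stub 2) concludes. The crux's
`let M …; let ipr …` are matched with the landed `transfer` / `ipr` by `change` (ζ/δ-reduction, as in
`fewIdle_of_diffuseBackwardInfluence`). `sorry` appears only inside the six registered stubs this theorem invokes. -/
theorem DiffuseBackwardInfluence_of
    (hT : Summit.AtomisticToContinuum.HydrodynamicLimit.Theses.CollisionIsometryCLT.TransferIsometry) :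
    Summit.AtomisticToContinuum.HydrodynamicLimit.Theses.CollisionIsometryCLT.DiffuseBackwardInfluence := by
  change (∀ (a₀ θ₀ : UnitAddTorus (Fin 3) → ℝ) (u₀ : UnitAddTorus (Fin 3) → EuclideanSpace ℝ (Fin 3)), Continuous a₀ → Continuous θ₀ → Continuous u₀ →
        (∀ x, 0 < a₀ x) → (∀ x, 0 < θ₀ x) →
        ∃ σ₀ : ℝ, 0 < σ₀ ∧ ∀ σ : ℝ, 0 < σ → σ < σ₀ →
          ∀ Φ : (N : ℕ) → HardSphereFlow (Torus.geometry (Fin 3)) (hsDiameter σ N) (N + 1),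
          ∀ Δ : ℕ → ℝ, (∀ N, 0 < Δ N) → Tendsto Δ atTop (𝓝 0) →
            Tendsto (fun N : ℕ => Δ N * ((N + 1 : ℕ) : ℝ) ^ ((1 : ℝ) / 3)) atTop atTop →
            ∀ t : ℝ, 0 < t →
              Tendsto (fun N : ℕ => ∫⁻ z, ENNReal.ofReal (ipr σ N ((Φ N).flow (t - Δ N) z) (Δ N))
                ∂(localGibbsLaw σ a₀ u₀ θ₀ N (Φ N))) atTop (𝓝 0))
  intro a₀ θ₀ u₀ ha hθ hu ha0 hθ0
  obtain ⟨σ₂, hσ₂, H2⟩ := stub_entropyTransfer a₀ θ₀ u₀ ha hθ hu ha0 hθ0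
  obtain ⟨σ₃, hσ₃, H3⟩ := stub_fewCollisionsSuperExp
  obtain ⟨σ₄, hσ₄, H4⟩ := stub_tightBondsSuperExp
  obtain ⟨σ₅, hσ₅, H5⟩ := stub_cageDichotomy
  obtain ⟨σ₆, hσ₆, H6⟩ := stub_dispersedNoReconcentration
  refine ⟨min (min σ₂ σ₃) (min (min σ₄ σ₅) (min σ₆ 2⁻¹)),
    lt_min (lt_min hσ₂ hσ₃) (lt_min (lt_min hσ₄ hσ₅) (lt_min hσ₆ (by norm_num))), ?_⟩
  intro σ hσ hσlt Φ
  have hlt2 : σ < σ₂ := lt_of_lt_of_le hσlt ((min_le_left _ _).trans (min_le_left _ _))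
  have hlt3 : σ < σ₃ := lt_of_lt_of_le hσlt ((min_le_left _ _).trans (min_le_right _ _))
  have hlt4 : σ < σ₄ :=
    lt_of_lt_of_le hσlt ((min_le_right _ _).trans ((min_le_left _ _).trans (min_le_left _ _)))
  have hlt5 : σ < σ₅ :=
    lt_of_lt_of_le hσlt ((min_le_right _ _).trans ((min_le_left _ _).trans (min_le_right _ _)))
  have hlt6 : σ < σ₆ :=
    lt_of_lt_of_le hσlt ((min_le_right _ _).trans ((min_le_right _ _).trans (min_le_left _ _)))
  -- invariance at θe = 1 (stub 1), in the consumed form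
  have hInv : EqInvariantAt σ := fun N Ψ s => stub_gibbsInvariance σ 1 N Ψ s one_pos
  -- the three tools and the two cage stubs at σ
  have h3σ : FewCollisionsSuperExpAt σ := H3 σ hσ hlt3
  have h4σ : TightBondsSuperExpAt σ := H4 σ hσ hlt4
  have h5σ : CageDichotomyAt σ := H5 σ hσ hlt5 hInv h4σ h3σ
  have h6σ : DispersedNoReconcentrationAt σ := H6 σ hσ hlt6 hInv h4σ h3σ
  -- the transferred crux C⁺ by the four-strata union bound
  have hE : EqSuperExpDelocalisationAt σ := eqSuperExpDelocalisation_of_strata h3σ h4σ h5σ h6σ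
  -- the entropy transfer (stub 2) with the row budget of `TransferIsometry`
  exact cruxConclusion_of hInv (rowBudget_of_transferIsometry hT σ) hE (H2 σ hσ hlt2 Φ)

/-! ## Consistency with the landed negative kernels (Disproof F3 / F5 / F7) -/

/-- A particle touched by no fold step of the window is counted POOR for every threshold `m` (Disproof F3: idle rows are
exactly the collision-poverty kernel, excluded from the residual event through `poorCount`). [folklore] -/
theorem poor_of_noOwnStep {σ : ℝ} {N : ℕ} {y : Cfg N} {Δ : ℝ} {i : Fin (N + 1)}
    (hi : ∀ k < colls σ N y Δ, ¬ OwnStep σ N y k i) (m : ℕ) : ownColl σ N y Δ i ≤ m := by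
  have h0 : ownSteps σ N y Δ i = ∅ := by
    unfold ownSteps
    refine Finset.filter_false_of_mem fun k hk => hi k (Finset.mem_range.1 hk)
  unfold ownColl
  rw [h0, Finset.card_empty]
  exact Nat.zero_le m

/-- If every own normal of `i` in the window is orthogonal to a unit vector `e` (the planar kernel F5 / free-direction
kernel F7 of the Disproof, on which `rowIpr_i ≥ 1` for ever), then `i` is `Λ`-undispersed for every `Λ > 0`: the
free-direction kernels live inside the loose-degenerate / bonded / poor strata, never in the residual event. [folklore] -/
theorem undispersed_of_orth {σ : ℝ} {N : ℕ} {y : Cfg N} {Δ : ℝ} {i : Fin (N + 1)} {e : EuclideanSpace ℝ (Fin 3)} (he : ‖e‖ = 1)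
    (hP : ∀ k < colls σ N y Δ, OwnStep σ N y k i → ⟪normalAt σ N y k, e⟫_ℝ = 0) {Λ : ℝ} (hΛ : 0 < Λ) :
    Undispersed σ N y Δ Λ i := by
  refine ⟨e, he, ?_⟩
  have h0 : normalSpread σ N y Δ i e = 0 := by
    unfold normalSpread
    refine Finset.sum_eq_zero fun k hk => ?_
    unfold ownSteps at hk
    rw [Finset.mem_filter, Finset.mem_range] at hk
    have h := hP k hk.1 hk.2
    unfold unitNormalAt
    rw [inner_smul_left, h]
    simp
  rw [h0]
  exact hΛ

/-- If EVERY particle is `Λ`-undispersed (e.g. on a planar window, by `undispersed_of_orth`), the three strata counts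
cover all `N + 1` particles: `poorCount + bondCount + looseDegCount ≥ N + 1`. Hence for `δ' ≤ 1/3` such a configuration
never lies in the residual event of S6 — the `_false_without_<normal non-degeneracy>` kernel is honoured. [folklore] -/
theorem strata_cover_of_allUndispersed {σ : ℝ} {N : ℕ} {y : Cfg N} {Δ Λ ρ : ℝ} {m : ℕ}
    (hU : ∀ i : Fin (N + 1), Undispersed σ N y Δ Λ i) :
    N + 1 ≤ poorCount σ N y Δ m + bondCount σ N ρ y + looseDegCount σ N y Δ m Λ ρ := by
  classical
  unfold poorCount bondCount looseDegCount
  set P := Finset.univ.filter (fun i : Fin (N + 1) => ownColl σ N y Δ i ≤ m) with hP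
  set Bd := Finset.univ.filter (fun i : Fin (N + 1) => Bonded σ N ρ y i) with hBd
  set L := Finset.univ.filter (fun i : Fin (N + 1) =>
    m < ownColl σ N y Δ i ∧ Undispersed σ N y Δ Λ i ∧ ¬ Bonded σ N ρ y i) with hL
  have hcover : (Finset.univ : Finset (Fin (N + 1))) ⊆ P ∪ Bd ∪ L := by
    intro i _
    simp only [Finset.mem_union, hP, hBd, hL, Finset.mem_filter, Finset.mem_univ, true_and]
    by_cases h1 : ownColl σ N y Δ i ≤ m
    · exact Or.inl (Or.inl h1)
    by_cases h2 : Bonded σ N ρ y i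
    · exact Or.inl (Or.inr h2)
    exact Or.inr ⟨not_le.1 h1, hU i, h2⟩
  calc N + 1 = (Finset.univ : Finset (Fin (N + 1))).card := by simp
    _ ≤ (P ∪ Bd ∪ L).card := Finset.card_le_card hcover
    _ ≤ (P ∪ Bd).card + L.card := Finset.card_union_le _ _
    _ ≤ P.card + Bd.card + L.card := Nat.add_le_add_right (Finset.card_union_le _ _) _

end

end Summit.AtomisticToContinuum.HydrodynamicLimit.Cruxes.DiffuseBackwardInfluence.CagedStratumPricing
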